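import Mathlib

/-!
# Route `LangevinControlUV`, crux `FemtoCurvatureTwoPointC` (stmt-QuantumFields-16204), line `Sketch`, reshape v6 —
# real sequences: non-negative + symmetric + log-convex ⇒ non-increasing on `[1, L/2]`

Registered stub `stub_antitoneOfLogConvex` of skeleton v6 (`Cruxes/FemtoCurvatureTwoPointC/Lines/Sketch.lean`), landed
`--supports stmt-QuantumFields-16204`. Pure real analysis (Mathlib only).
-/

set_option autoImplicit false

namespace Summit.QuantumFields.YangMills.Theorems.FemtoCurvatureTwoPointC

/-- **Registered stub `stub_antitoneOfLogConvex`** (line `Sketch`, skeleton v6, `--supports stmt-QuantumFields-16204`): real sequences: non-negative + symmetric + log-convex ⇒ non-increasing on `[1, L/2]`. Pure real analysis (Mathlib only). [folklore] -/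
theorem stub_antitoneOfLogConvex :
    ∀ (L : ℕ) (g : ℕ → ℝ), (∀ s : ℕ, 0 ≤ g s) → (∀ s : ℕ, s ≤ L → g (L - s) = g s) → (∀ c : ℕ, 2 ≤ c → c + 2 ≤ L → g c ^ 2 ≤ g (c - 1) * g (c + 1)) → ∀ (k n : ℕ), 1 ≤ k → k ≤ n → 2 * n ≤ L → g n ≤ g k := by
  intro L g hnn hsym hlc k n hk hkn hn
  -- from `g(m+1)² ≤ g(m) g(m+1)` to `g(m+1) ≤ g(m)`
  have hdiv : ∀ m, g (m + 1) ^ 2 ≤ g m * g (m + 1) → g (m + 1) ≤ g m := fun m h => by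
    by_cases h0 : g (m + 1) = 0
    · rw [h0]; exact hnn m
    · have hpos : 0 < g (m + 1) := lt_of_le_of_ne (hnn _) (Ne.symm h0)
      refine le_of_mul_le_mul_right ?_ hpos
      nlinarith [h]
  -- one step down, by downward induction from `L/2` (centres `m + 1 ≥ 2`)
  have hstep : ∀ j m, 1 ≤ m → m + 1 + j = L / 2 → g (m + 1) ≤ g m := by
    intro j
    induction j with
    | zero =>
      intro m hm1 hm
      have h := hlc (m + 1) (by omega) (by omega)
      simp only [Nat.add_sub_cancel] at h
      rcases Nat.even_or_odd L with hL | hL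
      · -- `L = 2(m+1)`: `g(m+2) = g(L - m) = g(m)`, so `g(m+1)² ≤ g(m)²`
        obtain ⟨r, hr⟩ := hL
        have e : g (m + 1 + 1) = g m := by
          rw [show m + 1 + 1 = L - m by omega]; exact hsym m (by omega)
        rw [e, ← sq] at h
        exact (pow_le_pow_iff_left₀ (hnn _) (hnn _) two_ne_zero).1 h
      · -- `L = 2(m+1) + 1`: `g(m+2) = g(L - (m+1)) = g(m+1)`
        obtain ⟨r, hr⟩ := hL
        have e : g (m + 1 + 1) = g (m + 1) := by
          rw [show m + 1 + 1 = L - (m + 1) by omega]; exact hsym (m + 1) (by omega)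
        rw [e] at h
        exact hdiv m h
    | succ j ih =>
      intro m hm1 hm
      have hnext : g (m + 1 + 1) ≤ g (m + 1) := ih (m + 1) (by omega) (by omega)
      have h := hlc (m + 1) (by omega) (by omega)
      simp only [Nat.add_sub_cancel] at h
      exact hdiv m (h.trans (mul_le_mul_of_nonneg_left hnext (hnn m)))
  -- chain the steps from `k` to `n`
  induction n, hkn using Nat.le_induction with
  | base => exact le_rfl
  | succ n hkn' ih =>
    have h1 : g (n + 1) ≤ g n := hstep (L / 2 - (n + 1)) n (by omega) (by omega)
    exact h1.trans (ih (by omega))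

end Summit.QuantumFields.YangMills.Theorems.FemtoCurvatureTwoPointC
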